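import Mathlib
import Summits.Ventures.LatticeQCDFlow.TrivializingMaps.WitnessColumnRP
import Summits.Ventures.LatticeQCDFlow.TrivializingMaps.WitnessVarianceFloor
import HarnessLib

/-!
# THEOREM V docked to THEOREM W — the hypothesis `0 < K_p(0)` is a theorem

HONEST FRAMING: exact (Metropolis-corrected) sampling algorithms for lattice gauge theory; figures of
merit are autocorrelation/cost numbers at stated couplings and volumes; no continuum-physics claim.

`WitnessColumnRP` (THEOREM W) carries the variance `v = K_X(0) = sliceCov ρ β X 0` (`sliceCov_zero`)
of a slice witness `X` as a hypothesis `0 < v`; `WitnessVarianceFloor` (THEOREM V) bounds the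
variance of every continuous plaquette function from below by `e^{-4N(d-1)|β|}` times its Haar
variance. Joined here for the plaquette witness `X = Re tr ρ(U_p)`:
* `plaqRe_sliceCov_zero_ge_haar` — any compact `G`, continuous `ρ`, real `β`, `L ≥ 2`:
  `e^{-4N(d-1)|β|} · Var_Haar(Re tr ρ) ≤ K_p(0)`;
* `plaqRe_sliceCov_zero_ge`, `plaqRe_sliceCov_zero_pos`, `plaqRe_sliceCov_zero_pos_of_even` —
  `G = SU(n)`, fundamental representation, `n ≥ 2`: `m₂(n) e^{-4n(d-1)|β|} ≤ K_p(0)`, hence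
  `0 < K_p(0)` at EVERY real `β` and every `L ≥ 2` (in particular every even `L ≠ 0`): the
  hypothesis `hv` of `plaqRe_sliceCov_geometric_lower` / `Gauge.sep_le_two_mul_range_of_plaquette`
  (`WitnessColumnPlaquette`) is discharged, and the INPUT column of the footprint law needs ONE
  measured number, `c_{p,2} = K_p(2)`.

NOT CLAIMED: `0 < K_p(2)` (it is `0` at `β = 0`); any statement for a representation with constant
`Re tr ρ` (there `K_p ≡ 0` and the general floor is `0 ≤ K_p(0)`).
-/

noncomputable section

namespace Summit.Ventures.LatticeQCDFlow.TrivializingMaps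

open MeasureTheory Literature.MathematicalPhysics.QuantumFieldTheory

namespace WitnessColumn

section General

variable {d L N : ℕ} [NeZero d] [NeZero L] {G : Type*} [Group G] [TopologicalSpace G]
  [IsTopologicalGroup G] [CompactSpace G] [MeasurableSpace G] [BorelSpace G]
  [SecondCountableTopology G] (ρ : G →* Matrix (Fin N) (Fin N) ℂ)

/-- **`K_p(0)` floor, any compact group.** For continuous `ρ`, real `β`, `L ≥ 2` and a plaquette `p`:
`e^{-4N(d-1)|β|} · (∫ (Re tr ρ)² dg - (∫ Re tr ρ dg)²) ≤ sliceCov ρ β (Re tr ρ(U_p)) 0`. -/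
theorem plaqRe_sliceCov_zero_ge_haar (hL : 2 ≤ L) (hρ : Continuous ρ) (β : ℝ) (p : Plaquette d L) :
    Real.exp (-(4 * N * ((d - 1 : ℕ) : ℝ) * |β|))
        * (∫ g, (ρ g).trace.re ^ 2 ∂haarProbability G - (∫ g, (ρ g).trace.re ∂haarProbability G) ^ 2)
      ≤ sliceCov ρ β (fun U : GaugeConfig d L G => WilsonRP.plaqRe ρ U p) 0 := by
  rw [sliceCov_zero]
  exact variance_plaquette_ge_haar ρ hL hρ β p (φ := fun g => (ρ g).trace.re)
    (Complex.continuous_re.comp hρ.matrix_trace)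

end General

section SUn

open Matrix

variable {d L n : ℕ} [NeZero d] [NeZero L]

/-- **`K_p(0)` floor for lattice `SU(n)`** (fundamental, `n ≥ 2`, real `β`, `L ≥ 2`):
`m₂(n) · e^{-4n(d-1)|β|} ≤ K_p(0)`, `m₂(n) = ∫_{SU(n)} (Re tr g)² dg` (`1` for `n = 2`, `½` for `n ≥ 3`). -/
theorem plaqRe_sliceCov_zero_ge (hL : 2 ≤ L) (hn : 2 ≤ n) (β : ℝ) (p : Plaquette d L) :
    (∫ g, ((g : Matrix (Fin n) (Fin n) ℂ)).trace.re ^ 2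
        ∂haarProbability (specialUnitaryGroup (Fin n) ℂ)) * Real.exp (-(4 * n * ((d - 1 : ℕ) : ℝ) * |β|))
      ≤ sliceCov (StrongCoupling.defRep n) β
          (fun U : GaugeConfig d L (specialUnitaryGroup (Fin n) ℂ) =>
            WilsonRP.plaqRe (StrongCoupling.defRep n) U p) 0 := by
  rw [sliceCov_zero]
  exact plaqRe_variance_floor hL hn β p

/-- **`0 < K_p(0)` for lattice `SU(n)`** (fundamental, `n ≥ 2`), at every real `β` and every `L ≥ 2`:
the hypothesis `hv` of THEOREM W (c)/(d) for the plaquette witness is a theorem. -/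
theorem plaqRe_sliceCov_zero_pos (hL : 2 ≤ L) (hn : 2 ≤ n) (β : ℝ) (p : Plaquette d L) :
    0 < sliceCov (StrongCoupling.defRep n) β
          (fun U : GaugeConfig d L (specialUnitaryGroup (Fin n) ℂ) =>
            WilsonRP.plaqRe (StrongCoupling.defRep n) U p) 0 := by
  rw [sliceCov_zero]
  exact plaqRe_variance_pos hL hn β p

/-- The same for every even `L` (`L ≠ 0` from `NeZero L`), the volume hypothesis of THEOREM W. -/
theorem plaqRe_sliceCov_zero_pos_of_even (hL : Even L) (hn : 2 ≤ n) (β : ℝ) (p : Plaquette d L) :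
    0 < sliceCov (StrongCoupling.defRep n) β
          (fun U : GaugeConfig d L (specialUnitaryGroup (Fin n) ℂ) =>
            WilsonRP.plaqRe (StrongCoupling.defRep n) U p) 0 := by
  obtain ⟨k, hk⟩ := hL
  have hL0 : L ≠ 0 := NeZero.ne L
  exact plaqRe_sliceCov_zero_pos (by omega) hn β p

end SUn

end WitnessColumn
end Summit.Ventures.LatticeQCDFlow.TrivializingMaps
end
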